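import Literature.NumberTheory.Automorphic.GLOneArchParameterOfAlgebraicCharacter
import Literature.NumberTheory.GaloisRepresentations.HeckeCharacterArchType
import HarnessLib

/-!
# `HalfIntegralTwistCM` (stmt-Langlands-14036) — negative knowledge I: the archimedean parameter of a
# `GL₁` datum, place by place

Sorry-free companion of the standing disprover's workfile `Cruxes/HalfIntegralTwistCM/Disproof.lean`
(cdisprove cycle 1) for the crux
`Summit.Langlands.Langlands.Theses.IrreducibilityBySelfDuality.HalfIntegralTwistCM`. Nothing here
asserts a Theses decl (the route file is not imported). For ANY number field `K` and ANY automorphic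
`GL₁` datum `π = W / W'` (Borel–Jacquet model) with Hecke character `χ` and archimedean parameter `P`:

* complex place `w`: `P σ_w = {p}`, `P σ̄_w = {q}`, `χ(det (exp a_w, 1)) = e^{a p + ā q}`
  (`archParam_complexPlace_glOne`); hence `p - q ∈ ℤ` (`archParam_embedding_sub_conj_mem_int_glOne`) —
  the constraint behind hypothesis (ii) of the crux — and `p - q = m_w` when `χ` has unitary
  archimedean type `(m, t)` (`archParam_sub_conj_eq_of_hasUnitaryArchType`);
* real place `w`: `P σ_w = {c}`, `χ(det (exp r·1_w, 1)) = e^{r c}` (`archParam_realPlace_glOne`);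
* the datum of the trivial character has parameter `{0}` everywhere (`archParam_trivial_glOne`), and
  `π_θ = ℂ·(θ∘det)/⊥` has Hecke character `θ` (`detTwist_datum_heckeCharacter`).
[folklore]
-/

noncomputable section

open scoped MatrixGroups Matrix Classical NumberField ComplexConjugate
open NumberField NumberField.InfinitePlace NumberField.mixedEmbedding IsDedekindDomain

namespace Summit.Langlands.Langlands.Theorems.HalfIntegralTwistCM.Negative

open Literature.NumberTheory.Automorphic
open Literature.NumberTheory.GaloisRepresentations

/-! ## §2 The archimedean parameter of a `GL₁` datum at a complex place (sorry-free)

For ANY number field `K` and ANY automorphic representation `π = W / W'` of `GL₁(𝔸_K)` in the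
tree's Borel–Jacquet model: the archimedean parameter at a complex place `w` is `{p}` at `σ_w` and
`{q}` at `σ̄_w`, and the Hecke character `χ_π` of `π` satisfies `χ_π(det (exp a_w, 1)) = e^{a p + ā q}`
(`heckeCharacter_glOne_det_ofArch_expMem` + Harish-Chandra clauses). Consequences:
`p - q ∈ ℤ` always (`exp (2πi)_w = 1`), and `p - q = m_w` when `χ_π` has unitary archimedean type
`(m, t)`. -/

variable {K : Type} [Field K] [NumberField K] {hcpt : isCompact_glFiniteIntegralLevel 1 K}

/-- **Core computation.** Let `π = W / W'` be an automorphic representation of `GL₁(𝔸_K)` with Hecke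
character `χ` (`r(g) φ - χ(det g) φ ∈ W'`) and archimedean parameter `P`, and let `w` be a complex
place. Then `P σ_w = {p}`, `P σ̄_w = {q}` and `χ(det (exp a_w, 1)) = e^{a p + ā q}` for every
`a ∈ ℂ = K_w` (`a_w ∈ 𝔤𝔩₁(K_∞)` the matrix `a` at `w`, `0` elsewhere). Gelbart 1975, §2.A;
Clozel 1990, §3.3; Knapp 2002, Thm. 5.44. [cite: Clozel1990, §3.3] -/
theorem archParam_complexPlace_glOne
    (π : AutomorphicRepData (AutomorphyDatum.gl 1 K hcpt)) {χ : HeckeCharacter K}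
    (hχ : ∀ (g : (AdelicGroupData.gl 1 K).Adelic), ∀ φ ∈ π.W,
      rightTranslation (AdelicGroupData.gl 1 K) g φ -
        ((χ (Matrix.GeneralLinearGroup.det g) : ℂˣ) : ℂ) • φ ∈ π.W')
    {P : (K →+* ℂ) → Multiset ℂ} (hP : π.HasArchParameter P)
    (w : {w : InfinitePlace K // w.IsComplex}) :
    ∃ p q : ℂ, P w.1.embedding = {p} ∧ P (ComplexEmbedding.conjugate w.1.embedding) = {q} ∧
      ∀ a : ℂ, ((χ (Matrix.GeneralLinearGroup.det (GLn.ofInfinite 1 K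
        (expGL (complexPlaceLie 1 w (a • (1 : Matrix (Fin 1) (Fin 1) ℂ)))))) : ℂˣ) : ℂ) =
          Complex.exp (a * p + conj a * q) := by
  classical
  -- the Lie algebra acts on the line `W / W'` through the real linear form `d'`
  obtain ⟨ρ, hρ⟩ := π.exists_hasLieAction_gl
  obtain ⟨d', hd'⟩ := π.exists_linearMap_lieAction_eq_smul_one_glOne ρ
  -- the link `χ(det (exp Y, 1)) = e^{d'(Y)}`
  have hlink : ∀ Y : Matrix (Fin 1) (Fin 1) (mixedSpace K),
      ((χ (Matrix.GeneralLinearGroup.det (GLn.ofInfinite 1 K (expGL Y))) : ℂˣ) : ℂ) =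
        Complex.exp (d' ⟨Y, trivial⟩) := by
    intro Y
    have h := π.heckeCharacter_glOne_det_ofArch_expMem hχ ⟨Y, trivial⟩
      (fun φ hφ => π.lieDeriv_sub_smul_mem_of_hasLieAction_glOne hρ hd' ⟨Y, trivial⟩ hφ) 1
    rw [one_smul, Complex.ofReal_one, one_mul] at h
    exact h
  -- the clauses of the archimedean parameter at the complex place `w`
  obtain ⟨-, hco⟩ := π.archParameter_clauses_glOne hρ d' hd' hP
  -- the real linear form `L(b) = d'(b_w)` and its decomposition along `τ ∈ {id, conj}`
  let L : ℂ →ₗ[ℝ] ℂ :=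
    { toFun := fun b => d' ⟨complexPlaceLie 1 w (b • (1 : Matrix (Fin 1) (Fin 1) ℂ)), trivial⟩
      map_add' := fun b c => by
        have : complexPlaceLie 1 w ((b + c) • (1 : Matrix (Fin 1) (Fin 1) ℂ)) =
            complexPlaceLie 1 w (b • (1 : Matrix (Fin 1) (Fin 1) ℂ)) +
              complexPlaceLie 1 w (c • (1 : Matrix (Fin 1) (Fin 1) ℂ)) := by
          rw [add_smul, map_add]
        rw [← map_add]
        exact congrArg d' (Subtype.ext this)
      map_smul' := fun r b => by
        have : complexPlaceLie 1 w ((r • b) • (1 : Matrix (Fin 1) (Fin 1) ℂ)) =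
            r • complexPlaceLie 1 w (b • (1 : Matrix (Fin 1) (Fin 1) ℂ)) := by
          rw [smul_assoc, map_smul]
        rw [RingHom.id_apply, ← map_smul]
        exact congrArg d' (Subtype.ext this) }
  have hL : ∀ b : ℂ, L b = d' ⟨complexPlaceLie 1 w (b • (1 : Matrix (Fin 1) (Fin 1) ℂ)), trivial⟩ :=
    fun b => rfl
  set p : ℂ := HCEmb.proj (L : ℂ → ℂ) (AlgHom.id ℝ ℂ) 1 with hp
  set q : ℂ := HCEmb.proj (L : ℂ → ℂ) (Complex.conjAe : ℂ →ₐ[ℝ] ℂ) 1 with hq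
  have hsum : ∀ a : ℂ, L a = a * p + conj a * q := by
    intro a
    have h := HCEmb.sum_proj (𝕜 := ℂ) L.toAddMonoidHom a
    rw [LinearMap.toAddMonoidHom_coe] at h
    rw [← h]
    obtain ⟨huniv, hne⟩ := univ_algHom_complex_eq
    rw [huniv, Finset.sum_pair hne]
    have h1 := HCEmb.proj_smul L (AlgHom.id ℝ ℂ) a (1 : ℂ)
    have h2 := HCEmb.proj_smul L (Complex.conjAe : ℂ →ₐ[ℝ] ℂ) a (1 : ℂ)
    rw [smul_eq_mul, mul_one, smul_eq_mul] at h1 h2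
    rw [h1, h2]
    rfl
  refine ⟨p, q, ?_, ?_, fun a => ?_⟩
  · have h := hco w (AlgHom.id ℝ ℂ)
    rwa [algHomId_toRingHom_comp] at h
  · have h := hco w (Complex.conjAe : ℂ →ₐ[ℝ] ℂ)
    rwa [conjAe_toRingHom_comp] at h
  · rw [hlink, show d' ⟨complexPlaceLie 1 w (a • (1 : Matrix (Fin 1) (Fin 1) ℂ)), trivial⟩ = L a
      from rfl, hsum]

/-- The idele `det (exp a_w, 1)` has coordinates `e^a` at `w` and `1` elsewhere; in particular it is
`1` for `a = 2πi`. [folklore] -/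
theorem det_ofInfinite_expGL_two_pi_I (w : {w : InfinitePlace K // w.IsComplex}) :
    Matrix.GeneralLinearGroup.det (GLn.ofInfinite 1 K
      (expGL (complexPlaceLie 1 w ((2 * Real.pi * Complex.I : ℂ) • (1 : Matrix (Fin 1) (Fin 1) ℂ))))) = 1 := by
  refine idele_eq_of_snd_eq_of_extensionEmbedding_eq K ?_ fun w' => ?_
  · rw [det_ofInfinite_snd]
    rfl
  · rw [extensionEmbedding_det_ofInfinite_expGL_complexPlaceLie]
    have h1 : Completion.extensionEmbedding w'
        (((1 : (AdeleRing (𝓞 K) K)ˣ) : AdeleRing (𝓞 K) K).1 w') = 1 := by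
      rw [Units.val_one]
      exact map_one _
    rw [h1]
    split_ifs
    · exact Complex.exp_two_pi_mul_I
    · rfl

/-- **Conjugate exponents of a `GL₁` datum differ by an integer.** If `π = W / W'` is an automorphic
representation of `GL₁(𝔸_K)` (ANY number field `K`) with archimedean parameter `P`, then at every
complex place `w`, `P σ_w = {p}` and `P σ̄_w = {q}` with `p - q ∈ ℤ` (the restriction of `π_w` to
the circle is `z ↦ z^{p-q}`; here: `1 = χ_π(det (exp (2πi)_w, 1)) = e^{2πi (p - q)}`). This is the
constraint that makes hypothesis (ii) of the crux load-bearing. Tate (1950), §2.3 (quasi-characters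
of `ℂˣ`); Clozel 1990, §3.3. [cite: TateThesis1967, §2.3] -/
theorem archParam_embedding_sub_conj_mem_int_glOne
    (π : AutomorphicRepData (AutomorphyDatum.gl 1 K hcpt)) {P : (K →+* ℂ) → Multiset ℂ}
    (hP : π.HasArchParameter P) (w : {w : InfinitePlace K // w.IsComplex}) :
    ∃ (p q : ℂ) (m : ℤ), P w.1.embedding = {p} ∧
      P (ComplexEmbedding.conjugate w.1.embedding) = {q} ∧ p - q = m := by
  obtain ⟨χ, hχ⟩ := π.exists_heckeCharacter_glOne
  obtain ⟨p, q, hPp, hPq, hval⟩ := archParam_complexPlace_glOne π hχ hP w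
  -- `e^{2πi (p - q)} = 1`
  have hexp : Complex.exp (2 * Real.pi * Complex.I * (p - q)) = 1 := by
    have h := hval (2 * Real.pi * Complex.I)
    rw [det_ofInfinite_expGL_two_pi_I, map_one, Units.val_one] at h
    rw [h]
    congr 1
    rw [map_mul, map_mul, Complex.conj_ofReal, Complex.conj_I, map_ofNat]
    ring
  obtain ⟨m, hm⟩ := Complex.exp_eq_one_iff.1 hexp
  refine ⟨p, q, m, hPp, hPq, ?_⟩
  have h2pi : (2 * Real.pi * Complex.I : ℂ) ≠ 0 := by
    simp [Real.pi_ne_zero, Complex.I_ne_zero]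
  exact mul_right_cancel₀ h2pi (show (p - q) * (2 * Real.pi * Complex.I) =
    m * (2 * Real.pi * Complex.I) by rw [← hm]; ring)

/-- `archUnitaryValue m t 1 = 1`. [folklore] -/
theorem archUnitaryValue_one (m : ℤ) (t : ℝ) : archUnitaryValue m t 1 = 1 := by
  simp [archUnitaryValue]

/-- `archUnitaryValue m t (e^{i s}) = e^{i s m}` for real `s` (the angular character of `ℂˣ`).
[folklore] -/
theorem archUnitaryValue_exp_mul_I (m : ℤ) (t : ℝ) (s : ℝ) :
    archUnitaryValue m t (Complex.exp (s * Complex.I)) = Complex.exp (s * Complex.I * m) := by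
  unfold archUnitaryValue
  rw [Complex.norm_exp_ofReal_mul_I, Complex.ofReal_one, div_one, Complex.one_cpow, mul_one,
    ← Complex.exp_int_mul]
  congr 1
  ring

/-- **The archimedean parameter of the datum of a Hecke character of unitary archimedean type.**
If the Hecke character `θ` of `π = W / W'` (`r(g) φ - θ(det g) φ ∈ W'`) has unitary archimedean type
`(m, t)` (`θ((x,1)) = ∏_w (ι_w x_w/|ι_w x_w|)^{m_w} |ι_w x_w|^{i t_w}`), then at a complex place `w` the
archimedean parameter `P` of `π` has `P σ_w = {p}`, `P σ̄_w = {q}` with `p - q = m_w` EXACTLY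
(evaluate `θ(det (exp (is)_w, 1)) = e^{is (p - q)}` against `(e^{is}/1)^{m_w} = e^{is m_w}`).
Tate (1950), §2.3; Patrikis 2019, §2.1. [cite: Patrikis2019, §2.1 (display before Lemma 2.1.1)] -/
theorem archParam_sub_conj_eq_of_hasUnitaryArchType
    (π : AutomorphicRepData (AutomorphyDatum.gl 1 K hcpt)) {θ : HeckeCharacter K}
    (hχ : ∀ (g : (AdelicGroupData.gl 1 K).Adelic), ∀ φ ∈ π.W,
      rightTranslation (AdelicGroupData.gl 1 K) g φ -
        ((θ (Matrix.GeneralLinearGroup.det g) : ℂˣ) : ℂ) • φ ∈ π.W')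
    {m : InfinitePlace K → ℤ} {t : InfinitePlace K → ℝ} (hθ : θ.HasUnitaryArchType m t)
    {P : (K →+* ℂ) → Multiset ℂ} (hP : π.HasArchParameter P)
    (w : {w : InfinitePlace K // w.IsComplex}) :
    ∃ p q : ℂ, P w.1.embedding = {p} ∧ P (ComplexEmbedding.conjugate w.1.embedding) = {q} ∧
      p - q = m w.1 := by
  obtain ⟨p, q, hPp, hPq, hval⟩ := archParam_complexPlace_glOne π hχ hP w
  refine ⟨p, q, hPp, hPq, ?_⟩
  -- `e^{is (p - q)} = e^{is m_w}` for every real `s`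
  have key : ∀ s : ℝ, Complex.exp (s * (Complex.I * (p - q))) = Complex.exp (s * (Complex.I * m w.1)) := by
    intro s
    have h := hval (s * Complex.I)
    -- left-hand side through the unitary archimedean type
    have hx := hθ (HeckeCharacter.infPart K (Matrix.GeneralLinearGroup.det (GLn.ofInfinite 1 K
      (expGL (complexPlaceLie 1 w (((s : ℂ) * Complex.I) • (1 : Matrix (Fin 1) (Fin 1) ℂ)))))))
    rw [infiniteIdeles_infPart_det_ofInfinite_expGL] at hx
    simp only [HeckeCharacter.val_infPart] at hx
    simp_rw [extensionEmbedding_det_ofInfinite_expGL_complexPlaceLie K w] at hx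
    rw [Finset.prod_eq_single w.1 (fun w' _ hw' => by rw [if_neg hw', archUnitaryValue_one])
      (fun h => absurd (Finset.mem_univ _) h), if_pos rfl, archUnitaryValue_exp_mul_I] at hx
    rw [hx] at h
    rw [show (s : ℂ) * (Complex.I * (m w.1 : ℂ)) = s * Complex.I * m w.1 by ring, h]
    congr 1
    rw [map_mul, Complex.conj_ofReal, Complex.conj_I]
    ring
  have e := eq_of_forall_cexp_mul_eq key
  have := mul_left_cancel₀ Complex.I_ne_zero e
  exact this

/-! ## Real places, the trivial datum, the datum of a character -/

/-- **Core computation at a real place.** For `π = W / W'` on `GL₁(𝔸_K)` with Hecke character `χ` and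
parameter `P`, at a real place `w`: `P σ_w = {c}` and `χ(det (exp (r·1_w), 1)) = e^{r c}` for all real
`r`. Gelbart 1975, §2.A; Clozel 1990, §3.3. [cite: Clozel1990, §3.3] -/
theorem archParam_realPlace_glOne
    (π : AutomorphicRepData (AutomorphyDatum.gl 1 K hcpt)) {χ : HeckeCharacter K}
    (hχ : ∀ (g : (AdelicGroupData.gl 1 K).Adelic), ∀ φ ∈ π.W,
      rightTranslation (AdelicGroupData.gl 1 K) g φ -
        ((χ (Matrix.GeneralLinearGroup.det g) : ℂˣ) : ℂ) • φ ∈ π.W')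
    {P : (K →+* ℂ) → Multiset ℂ} (hP : π.HasArchParameter P)
    (w : {w : InfinitePlace K // w.IsReal}) :
    ∃ c : ℂ, P w.1.embedding = {c} ∧
      ∀ r : ℝ, ((χ (Matrix.GeneralLinearGroup.det (GLn.ofInfinite 1 K
        (expGL (realPlaceLie 1 w (r • (1 : Matrix (Fin 1) (Fin 1) ℝ)))))) : ℂˣ) : ℂ) =
          Complex.exp (r * c) := by
  classical
  obtain ⟨ρ, hρ⟩ := π.exists_hasLieAction_gl
  obtain ⟨d', hd'⟩ := π.exists_linearMap_lieAction_eq_smul_one_glOne ρ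
  have hlink : ∀ Y : Matrix (Fin 1) (Fin 1) (mixedSpace K),
      ((χ (Matrix.GeneralLinearGroup.det (GLn.ofInfinite 1 K (expGL Y))) : ℂˣ) : ℂ) =
        Complex.exp (d' ⟨Y, trivial⟩) := by
    intro Y
    have h := π.heckeCharacter_glOne_det_ofArch_expMem hχ ⟨Y, trivial⟩
      (fun φ hφ => π.lieDeriv_sub_smul_mem_of_hasLieAction_glOne hρ hd' ⟨Y, trivial⟩ hφ) 1
    rw [one_smul, Complex.ofReal_one, one_mul] at h
    exact h
  obtain ⟨hre, -⟩ := π.archParameter_clauses_glOne hρ d' hd' hP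
  refine ⟨d' ⟨realPlaceLie 1 w 1, trivial⟩, hre w, fun r => ?_⟩
  rw [hlink]
  congr 1
  have : (⟨realPlaceLie 1 w (r • (1 : Matrix (Fin 1) (Fin 1) ℝ)), trivial⟩ :
      (AutomorphyDatum.gl 1 K hcpt).arch.lie) = r • ⟨realPlaceLie 1 w 1, trivial⟩ := by
    refine Subtype.ext ?_
    change realPlaceLie 1 w (r • (1 : Matrix (Fin 1) (Fin 1) ℝ)) = r • realPlaceLie 1 w 1
    rw [map_smul]
  rw [this, map_smul, Complex.real_smul]

/-- **The datum of the trivial character has parameter `0` everywhere**: if `𝟙 = r(g)`-scalar of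
`π` (`r(g) φ - φ ∈ W'`), then `P ι = {0}` for all `ι`. [folklore] -/
theorem archParam_trivial_glOne
    (π : AutomorphicRepData (AutomorphyDatum.gl 1 K hcpt))
    (hχ : ∀ (g : (AdelicGroupData.gl 1 K).Adelic), ∀ φ ∈ π.W,
      rightTranslation (AdelicGroupData.gl 1 K) g φ -
        (((1 : HeckeCharacter K) (Matrix.GeneralLinearGroup.det g) : ℂˣ) : ℂ) • φ ∈ π.W')
    {P : (K →+* ℂ) → Multiset ℂ} (hP : π.HasArchParameter P) (ι : K →+* ℂ) : P ι = {0} := by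
  rcases (InfinitePlace.mk ι).isReal_or_isComplex with hw | hw
  · -- real place
    obtain ⟨c, hc, hval⟩ := archParam_realPlace_glOne π hχ hP ⟨InfinitePlace.mk ι, hw⟩
    have hc0 : c = 0 := by
      refine eq_of_forall_cexp_mul_eq fun t => ?_
      rw [← hval t, HeckeCharacter.one_apply, Units.val_one, mul_zero, Complex.exp_zero]
    have e : (InfinitePlace.mk ι).embedding = ι := embedding_mk_eq_of_isReal (isReal_mk_iff.mp hw)
    rw [← e]
    rw [hc0] at hc
    exact hc
  · -- complex place
    obtain ⟨p, q, hp, hq, hval⟩ := archParam_complexPlace_glOne π hχ hP ⟨InfinitePlace.mk ι, hw⟩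
    have hsum : p + q = 0 := by
      refine eq_of_forall_cexp_mul_eq fun t => ?_
      have h := hval t
      rw [HeckeCharacter.one_apply, Units.val_one, Complex.conj_ofReal] at h
      rw [mul_zero, Complex.exp_zero, h]
      congr 1
      ring
    have hdiff : Complex.I * (p - q) = 0 := by
      refine eq_of_forall_cexp_mul_eq fun t => ?_
      have h := hval (t * Complex.I)
      rw [HeckeCharacter.one_apply, Units.val_one, map_mul, Complex.conj_ofReal, Complex.conj_I] at h
      rw [mul_zero, Complex.exp_zero, h]
      congr 1
      ring
    have hp0 : p = 0 := by
      have := mul_left_cancel₀ Complex.I_ne_zero (hdiff.trans (mul_zero _).symm)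
      linear_combination (hsum + this) / 2
    have hq0 : q = 0 := by rw [hp0, zero_add] at hsum; exact hsum
    rcases InfinitePlace.mk_eq_iff.mp (InfinitePlace.mk_embedding (InfinitePlace.mk ι)) with hι | hι
    · have hp' : P (InfinitePlace.mk ι).embedding = {p} := hp
      rw [hι, hp0] at hp'
      exact hp'
    · have hq' : P (ComplexEmbedding.conjugate (InfinitePlace.mk ι).embedding) = {q} := hq
      rw [hι, hq0] at hq'
      exact hq'

/-- The `GL₁` datum `π_θ = ℂ·(θ∘det)/⊥` of a Hecke character has `θ` as its Hecke character:
`r(g) φ - θ(det g) φ ∈ W'` for all `φ ∈ W`. [folklore] -/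
theorem detTwist_datum_heckeCharacter {θ : HeckeCharacter K}
    {π : AutomorphicRepData (AutomorphyDatum.gl 1 K hcpt)}
    (hW : π.W = Submodule.span ℂ {fun g : (AdelicGroupData.gl 1 K).Adelic => (detTwist 1 θ g : ℂ)}) :
    ∀ (g : (AdelicGroupData.gl 1 K).Adelic), ∀ φ ∈ π.W,
      rightTranslation (AdelicGroupData.gl 1 K) g φ -
        ((θ (Matrix.GeneralLinearGroup.det g) : ℂˣ) : ℂ) • φ ∈ π.W' := by
  intro g φ hφ
  rw [hW] at hφ
  obtain ⟨a, rfl⟩ := Submodule.mem_span_singleton.1 hφ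
  have h0 : rightTranslation (AdelicGroupData.gl 1 K) g
      (a • fun g : (AdelicGroupData.gl 1 K).Adelic => (detTwist 1 θ g : ℂ)) -
        ((θ (Matrix.GeneralLinearGroup.det g) : ℂˣ) : ℂ) •
          (a • fun g : (AdelicGroupData.gl 1 K).Adelic => (detTwist 1 θ g : ℂ)) = 0 := by
    rw [map_smul, rightTranslation_detTwist_glOne, smul_comm, detTwist_apply', sub_self]
  rw [h0]
  exact Submodule.zero_mem _

end Summit.Langlands.Langlands.Theorems.HalfIntegralTwistCM.Negative
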